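import Summits.CriticalPhenomena.PercolationContinuityZ3.Theses.PercLowPointHalfSpace
import Literature.Probability.Percolation.CriticalContinuityProofs
import Literature.Probability.Percolation.SlabCriticality

/-!
# `TallClusterMassBound` (stmt-CriticalPhenomena-0912) — the mass-exponent family: structure and the floor `m ≥ 1`

Negative-side support for the crux `Summit.CriticalPhenomena.PercolationContinuityZ3.Theses.PercLowPointHalfSpace.
TallClusterMassBound` (B of route PercLowPointHalfSpace), extracted from the standing disprover's work file
`Cruxes/TallClusterMassBound/Disproof.lean` §0–§2 (evidence on the item). Nothing here asserts the crux.

* §0 `MassBoundAt p s` : `M_p(r) ≤ C r^s π_p(r)` for all `r ≥ 1`, where `M_p(r) = Σ_{x ∈ box 3 r} P_p(0 ↔_ℍ x ∧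
  arm_ℍ(0,r))` and `π_p(r) = P_p(arm_ℍ(0,r))`; `tallClusterMassBound_iff` : the crux is `MassBoundAt p_c (11/4)`
  (`Iff.rfl`).
* §1 `massBoundAt_three` (exponent `3` holds for EVERY `p`: the content of the crux is the `1/4`),
  `massBoundAt_mono`; §1b `not_forall_rpow_le` (exponent comparison helper).
* §2 `succ_mul_armProb_le_mass` : `(r+1) π_p(r) ≤ M_p(r)` (an open lattice path to sup-distance `r` passes through
  every sup-norm level — discrete intermediate values along a walk), whence the refuted over-strengthening
  `not_massBoundAt_criticalProbI_of_lt_one` : `¬ MassBoundAt p_c s` for every `s < 1`; `armProb_pos` (an open column,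
  `p_c(ℤ³) > 0` from `criticalProb_zd_pos`).
-/

noncomputable section

open MeasureTheory ProbabilityTheory Filter
open Literature.Probability.Percolation Literature.Probability.LatticeModels
open Summit.CriticalPhenomena.PercolationContinuityZ3.Theses.PercLowPointHalfSpace (TallClusterMassBound)

namespace Summit.CriticalPhenomena.PercolationContinuityZ3.Theorems.TallClusterMassBound.Negative

/-! ## §0 Vocabulary: the crux as the point `(p, s) = (p_c, 11/4)` of a two-parameter family -/

/-- Vertices of `ℤ³`. [folklore] -/
abbrev V3 : Type := Site 3

/-- The half-space `ℍ = {x | 0 ≤ x₀}` exactly as written in the route file. [folklore] -/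
def Hs : Set V3 := {x | 0 ≤ x 0}

/-- Bond percolation on `ℤ³` at parameter `p`. [folklore] -/
def Pp (p : unitInterval) : Measure (BondConfig V3) := bondPercolation (zdGraph 3) p

/-- `P_p` is a probability measure. [folklore] -/
instance (p : unitInterval) : IsProbabilityMeasure (Pp p) := by
  unfold Pp; infer_instance

/-- `{0 ↔ x in ℍ}`. [folklore] -/
def conn (x : V3) : Set (BondConfig V3) := openConnIn Hs 0 x

/-- `arm_ℍ(0, r)`: the half-space cluster of `0` reaches sup-distance `≥ r`. [folklore] -/
def arm (r : ℕ) : Set (BondConfig V3) :=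
  {ω | ∃ y : V3, (∃ i : Fin 3, (r : ℤ) ≤ |y i|) ∧ ω ∈ openConnIn Hs 0 y}

/-- `M_p(r) = E_p[|C_ℍ(0) ∩ B_r| ; arm_ℍ(0,r)] = Σ_{x ∈ B_r} P_p(0 ↔_ℍ x, arm_ℍ(0,r))`. [folklore] -/
def mass (p : unitInterval) (r : ℕ) : ℝ := ∑ x ∈ box 3 r, (Pp p).real (conn x ∩ arm r)

/-- `π_p(r) = P_p(arm_ℍ(0, r))`. [folklore] -/
def armProb (p : unitInterval) (r : ℕ) : ℝ := (Pp p).real (arm r)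

/-- The two-parameter family: `M_p(r) ≤ C r^s π_p(r)` for all `r ≥ 1`. The crux is the point
`(p_c(ℤ³), 11/4)` (`tallClusterMassBound_iff`). [folklore] -/
def MassBoundAt (p : unitInterval) (s : ℝ) : Prop :=
  ∃ C : ℝ, ∀ r : ℕ, 1 ≤ r → mass p r ≤ C * (r : ℝ) ^ s * armProb p r

/-- The crux, verbatim, is `MassBoundAt p_c (11/4)`. [folklore] -/
theorem tallClusterMassBound_iff :
    TallClusterMassBound ↔ MassBoundAt (criticalProbI 3) ((11 : ℝ) / 4) := Iff.rfl

/-! ## §1 The content is the exponent: `s = 3` is free for EVERY `p`, and `s ↦ MassBoundAt p s` is monotone -/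

/-- `P_p(0 ↔_ℍ x ∧ arm_r) ≤ π_p(r)`. [folklore] -/
theorem real_conn_inter_arm_le (p : unitInterval) (x : V3) (r : ℕ) :
    (Pp p).real (conn x ∩ arm r) ≤ armProb p r :=
  measureReal_mono Set.inter_subset_right

/-- `π_p(r) ≥ 0`. [folklore] -/
theorem armProb_nonneg (p : unitInterval) (r : ℕ) : 0 ≤ armProb p r := measureReal_nonneg

/-- `π_p(r) ≤ 1`. [folklore] -/
theorem armProb_le_one (p : unitInterval) (r : ℕ) : armProb p r ≤ 1 := measureReal_le_one

/-- `M_p(r) ≥ 0`. [folklore] -/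
theorem mass_nonneg (p : unitInterval) (r : ℕ) : 0 ≤ mass p r :=
  Finset.sum_nonneg fun _ _ => measureReal_nonneg

/-- The trivial volume bound `M_p(r) ≤ |B_r| π_p(r) = (2r+1)³ π_p(r)`. [folklore] -/
theorem mass_le_card_mul (p : unitInterval) (r : ℕ) :
    mass p r ≤ (2 * (r : ℝ) + 1) ^ 3 * armProb p r := by
  unfold mass
  calc ∑ x ∈ box 3 r, (Pp p).real (conn x ∩ arm r)
      ≤ ∑ _x ∈ box 3 r, armProb p r := Finset.sum_le_sum fun x _ => real_conn_inter_arm_le p x r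
    _ = ((box 3 r).card : ℝ) * armProb p r := by rw [Finset.sum_const, nsmul_eq_mul]
    _ = (2 * (r : ℝ) + 1) ^ 3 * armProb p r := by rw [card_box]; push_cast; ring

/-- `MassBoundAt p 3` holds for every parameter `p` (with `C = 27`): exponent `3` carries no
information; the crux is exactly the improvement `3 ↦ 11/4`. [folklore] -/
theorem massBoundAt_three (p : unitInterval) : MassBoundAt p 3 := by
  refine ⟨27, fun r hr => (mass_le_card_mul p r).trans ?_⟩
  have hr' : (1 : ℝ) ≤ r := by exact_mod_cast hr
  have h3 : (r : ℝ) ^ (3 : ℝ) = (r : ℝ) ^ (3 : ℕ) := by exact_mod_cast Real.rpow_natCast (r : ℝ) 3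
  rw [h3]
  have hπ := armProb_nonneg p r
  have h27 : (2 * (r : ℝ) + 1) ^ 3 ≤ 27 * (r : ℝ) ^ (3 : ℕ) := by
    have : (2 * (r : ℝ) + 1) ^ 3 ≤ (3 * (r : ℝ)) ^ 3 :=
      pow_le_pow_left₀ (by linarith) (by linarith) 3
    linarith [show (3 * (r : ℝ)) ^ 3 = 27 * (r : ℝ) ^ 3 by ring]
  exact mul_le_mul_of_nonneg_right h27 hπ

/-- Monotonicity in the exponent (for `r ≥ 1`, `r^s ≤ r^t`). [folklore] -/
theorem massBoundAt_mono {p : unitInterval} {s t : ℝ} (hst : s ≤ t) (h : MassBoundAt p s) :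
    MassBoundAt p t := by
  obtain ⟨C, hC⟩ := h
  refine ⟨max C 0, fun r hr => (hC r hr).trans ?_⟩
  have hr' : (1 : ℝ) ≤ r := by exact_mod_cast hr
  have hπ := armProb_nonneg p r
  have h1 : C * (r : ℝ) ^ s ≤ max C 0 * (r : ℝ) ^ s :=
    mul_le_mul_of_nonneg_right (le_max_left _ _) (Real.rpow_nonneg (by linarith) _)
  have h2 : max C 0 * (r : ℝ) ^ s ≤ max C 0 * (r : ℝ) ^ t :=
    mul_le_mul_of_nonneg_left (Real.rpow_le_rpow_of_exponent_le hr' hst) (le_max_right _ _)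
  exact mul_le_mul_of_nonneg_right (h1.trans h2) hπ

/-! ## §1b An analytic helper: `c r^t ≤ C r^s` for all `r ≥ 1` is impossible when `s < t`, `c > 0` -/

/-- For `a > 0` the powers `r^a`, `r ∈ ℕ`, are unbounded. [folklore] -/
theorem exists_nat_lt_rpow (C : ℝ) {a : ℝ} (ha : 0 < a) : ∃ r : ℕ, 1 ≤ r ∧ C < (r : ℝ) ^ a := by
  have h1 : Tendsto (fun r : ℕ => (r : ℝ) ^ a) atTop atTop :=
    (tendsto_rpow_atTop ha).comp tendsto_natCast_atTop_atTop
  obtain ⟨r, hr⟩ := ((h1.eventually_gt_atTop C).and (eventually_ge_atTop 1)).exists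
  exact ⟨r, hr.2, hr.1⟩

/-- If `0 < c` and `s < t` then `c r^t ≤ C r^s` fails for some natural `r ≥ 1`. [folklore] -/
theorem not_forall_rpow_le {c C s t : ℝ} (hc : 0 < c) (hst : s < t) :
    ¬ ∀ r : ℕ, 1 ≤ r → c * (r : ℝ) ^ t ≤ C * (r : ℝ) ^ s := by
  intro h
  obtain ⟨r, hr1, hr⟩ := exists_nat_lt_rpow (C / c) (sub_pos.2 hst)
  have hr0 : (0 : ℝ) < r := by exact_mod_cast hr1
  have key := h r hr1
  have hsplit : (r : ℝ) ^ t = (r : ℝ) ^ (t - s) * (r : ℝ) ^ s := by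
    rw [← Real.rpow_add hr0]; ring_nf
  have hrs : 0 < (r : ℝ) ^ s := Real.rpow_pos_of_pos hr0 s
  have hlt : C * (r : ℝ) ^ s < c * (r : ℝ) ^ t := by
    rw [hsplit]
    have : C < c * (r : ℝ) ^ (t - s) := by
      have := mul_lt_mul_of_pos_left hr hc
      rwa [mul_div_cancel₀ _ hc.ne'] at this
    calc C * (r : ℝ) ^ s < c * (r : ℝ) ^ (t - s) * (r : ℝ) ^ s := mul_lt_mul_of_pos_right this hrs
      _ = c * ((r : ℝ) ^ (t - s) * (r : ℝ) ^ s) := by ring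
  linarith


/-! ## §2 A rigorous LOWER bound `M_p(r) ≥ (r+1) π_p(r)`: the over-strengthening `s < 1` is false

On `arm_ℍ(0,r)` an open lattice path in `ℍ` runs from `0` to sup-distance `≥ r`; its sup-norm changes
by at most one per step, so it visits vertices of every sup-norm `0, 1, …, r`, all in `B_r` and all
joined to `0` in `ℍ`: `|C_ℍ(0) ∩ B_r| ≥ r + 1` on the arm event (for configurations opening only
lattice edges, an almost sure event). -/

/-- The sup-norm on `ℤ³`, written out coordinatewise. [folklore] -/
def snorm (z : V3) : ℕ := max (max (z 0).natAbs (z 1).natAbs) (z 2).natAbs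

/-- `∀ i : Fin 3` unrolled. [folklore] -/
theorem forall_fin3 {P : Fin 3 → Prop} : (∀ i, P i) ↔ P 0 ∧ P 1 ∧ P 2 :=
  ⟨fun h => ⟨h 0, h 1, h 2⟩, fun h i => by fin_cases i; exacts [h.1, h.2.1, h.2.2]⟩

/-- The origin has sup-norm `0`. [folklore] -/
@[simp] theorem snorm_zero : snorm 0 = 0 := by simp [snorm]

/-- `box 3 r` is the sup-norm ball of radius `r`. [folklore] -/
theorem mem_box_iff_snorm {r : ℕ} {z : V3} : z ∈ box 3 r ↔ snorm z ≤ r := by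
  rw [mem_box, forall_fin3]
  simp only [snorm]
  omega

/-- The route's 'far' predicate `∃ i, r ≤ |z i|` is `r ≤ ‖z‖∞`. [folklore] -/
theorem far_iff_snorm {r : ℕ} {z : V3} : (∃ i : Fin 3, (r : ℤ) ≤ |z i|) ↔ r ≤ snorm z := by
  rw [exists_fin_three]
  simp only [snorm, Int.abs_eq_natAbs, Nat.cast_le]
  omega

/-- One lattice step changes the sup-norm by at most one. [folklore] -/
theorem snorm_le_of_adj {z z' : V3} (h : (zdGraph 3).Adj z z') : snorm z' ≤ snorm z + 1 := by
  rw [zdGraph_adj_iff] at h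
  obtain ⟨i, h | h⟩ := h
  · subst h
    fin_cases i <;> simp [snorm] <;> omega
  · subst h
    fin_cases i <;> simp [snorm] <;> omega

/-- Discrete intermediate values along a walk for a function with unit upward steps. [folklore] -/
theorem exists_mem_support_eq {W : Type*} {K : SimpleGraph W} (f : W → ℕ)
    (hf : ∀ u v, K.Adj u v → f v ≤ f u + 1) {u v : W} (w : K.Walk u v) {k : ℕ}
    (hku : f u ≤ k) (hkv : k ≤ f v) : ∃ z ∈ w.support, f z = k := by
  induction w with
  | @nil u => exact ⟨u, by simp, le_antisymm hku hkv⟩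
  | @cons a b c hab w ih =>
    by_cases hk : f a = k
    · exact ⟨a, by simp, hk⟩
    · have hb : f b ≤ k := by have := hf a b hab; omega
      obtain ⟨z, hz, hfz⟩ := ih hb hkv
      exact ⟨z, by simp [hz], hfz⟩

/-- `0 ∈ ℍ`. [folklore] -/
theorem zero_mem_Hs : (0 : V3) ∈ Hs := by
  change (0 : ℤ) ≤ (0 : V3) 0
  simp

/-- `ω ∈ conn x` is reachability `0 → x` in the graph of open steps inside `ℍ`. [folklore] -/
theorem mem_conn_iff {ω : BondConfig V3} {x : V3} :
    ω ∈ conn x ↔ (openGraph ω ⊓ withinGraph ⊤ Hs).Reachable 0 x := by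
  rw [conn, openConnIn_eq_openConnVia zero_mem_Hs]
  exact mem_openClusterIn_iff

/-- `ω ∈ arm r` is: some `y` with `‖y‖∞ ≥ r` is reachable from `0` by open steps inside `ℍ`. [folklore] -/
theorem mem_arm_iff {ω : BondConfig V3} {r : ℕ} :
    ω ∈ arm r ↔ ∃ y : V3, r ≤ snorm y ∧ (openGraph ω ⊓ withinGraph ⊤ Hs).Reachable 0 y := by
  simp only [arm, Set.mem_setOf_eq, far_iff_snorm]
  refine exists_congr fun y => and_congr_right fun _ => ?_
  rw [openConnIn_eq_openConnVia zero_mem_Hs]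
  exact mem_openClusterIn_iff

open scoped Classical in
/-- COUNTING LEMMA: on the arm event, at least `r + 1` vertices of `B_r` are joined to `0` in `ℍ`
(configurations opening only lattice edges). [folklore] -/
theorem card_conn_ge {ω : BondConfig V3} (hω : ω ⊆ (zdGraph 3).edgeSet) {r : ℕ} (hr : ω ∈ arm r) :
    r + 1 ≤ ((box 3 r).filter fun x => ω ∈ conn x).card := by
  classical
  obtain ⟨y, hy, ⟨w⟩⟩ := mem_arm_iff.1 hr
  have hK : ∀ u v, (openGraph ω ⊓ withinGraph ⊤ Hs).Adj u v → snorm v ≤ snorm u + 1 := by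
    intro u v h
    have h1 : (openGraph ω).Adj u v := h.1
    rw [openGraph_adj] at h1
    exact snorm_le_of_adj ((SimpleGraph.mem_edgeSet (G := zdGraph 3)).1 (hω h1.1))
  have hex : ∀ k, k ≤ r → ∃ z, z ∈ w.support ∧ snorm z = k := fun k hk =>
    exists_mem_support_eq snorm hK w (by simp) (hk.trans hy)
  choose! g hg using hex
  have hmaps : Set.MapsTo g ↑(Finset.range (r + 1)) ↑((box 3 r).filter fun x => ω ∈ conn x) := by
    intro k hk
    rw [Finset.coe_range, Set.mem_Iio, Nat.lt_succ_iff] at hk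
    obtain ⟨hsupp, hnorm⟩ := hg k hk
    rw [Finset.mem_coe, Finset.mem_filter]
    refine ⟨mem_box_iff_snorm.2 (hnorm.le.trans hk), ?_⟩
    rw [mem_conn_iff]
    obtain ⟨q, -, -⟩ := SimpleGraph.Walk.mem_support_iff_exists_append.1 hsupp
    exact ⟨q⟩
  have hinj : Set.InjOn g ↑(Finset.range (r + 1)) := by
    intro a ha b hb hab
    rw [Finset.coe_range, Set.mem_Iio, Nat.lt_succ_iff] at ha hb
    rw [← (hg a ha).2, ← (hg b hb).2, hab]
  calc r + 1 = (Finset.range (r + 1)).card := (Finset.card_range _).symm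
    _ ≤ _ := Finset.card_le_card_of_injOn g hmaps hinj

/-- `{0 ↔_ℍ x}` is measurable. [folklore] -/
theorem measurableSet_conn (x : V3) : MeasurableSet (conn x) :=
  measurableSet_openConnIn_of_countable _ _ _

/-- `arm_ℍ(0,r)` is measurable (a countable union of connection events). [folklore] -/
theorem measurableSet_arm (r : ℕ) : MeasurableSet (arm r) := by
  have : arm r = ⋃ y : V3, ⋃ (_ : ∃ i : Fin 3, (r : ℤ) ≤ |y i|), openConnIn Hs 0 y := by
    ext ω; simp [arm]
  rw [this]
  exact MeasurableSet.iUnion fun y => MeasurableSet.iUnion fun _ =>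
    measurableSet_openConnIn_of_countable _ _ _

/-- Almost every configuration opens only lattice edges. [folklore] -/
theorem ae_subset_edgeSet (p : unitInterval) : ∀ᵐ ω ∂Pp p, ω ⊆ (zdGraph 3).edgeSet :=
  setBernoulli_ae_subset

/-- LOWER BOUND: `(r + 1) π_p(r) ≤ M_p(r)` for every `p` and `r`. [folklore] -/
theorem succ_mul_armProb_le_mass (p : unitInterval) (r : ℕ) :
    ((r : ℝ) + 1) * armProb p r ≤ mass p r := by
  classical
  have hA := measurableSet_arm r
  have hC := measurableSet_conn
  have lhs : ((r : ℝ) + 1) * armProb p r =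
      ∫ ω, ((r : ℝ) + 1) * (arm r).indicator (1 : BondConfig V3 → ℝ) ω ∂Pp p := by
    rw [integral_const_mul, integral_indicator_one hA]; rfl
  have rhs : mass p r =
      ∫ ω, ∑ x ∈ box 3 r, (conn x ∩ arm r).indicator (1 : BondConfig V3 → ℝ) ω ∂Pp p := by
    rw [integral_finsetSum]
    · refine Finset.sum_congr rfl fun x _ => ?_
      rw [integral_indicator_one ((hC x).inter hA)]
    · intro x _
      exact (integrable_const (1 : ℝ)).indicator ((hC x).inter hA)
  rw [lhs, rhs]
  refine integral_mono_ae ?_ ?_ ?_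
  · exact ((integrable_const (1 : ℝ)).indicator hA).const_mul _
  · exact integrable_finsetSum _ fun x _ => (integrable_const (1 : ℝ)).indicator ((hC x).inter hA)
  · filter_upwards [ae_subset_edgeSet p] with ω hω
    by_cases hω' : ω ∈ arm r
    · have hsum : ∑ x ∈ box 3 r, (conn x ∩ arm r).indicator (1 : BondConfig V3 → ℝ) ω =
          (((box 3 r).filter fun x => ω ∈ conn x).card : ℝ) := by
        rw [← Finset.sum_boole]
        refine Finset.sum_congr rfl fun x _ => ?_
        simp [Set.indicator_apply, hω']
      simp only [Set.indicator_of_mem hω', Pi.one_apply, mul_one, hsum]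
      exact_mod_cast card_conn_ge hω hω'
    · simp only [Set.indicator_of_notMem hω', mul_zero]
      exact Finset.sum_nonneg fun x _ => Set.indicator_nonneg (fun _ _ => zero_le_one) _

/-- `MassBoundAt p s` with `s < 1` is false as soon as the arm probabilities are positive. [folklore] -/
theorem not_massBoundAt_of_lt_one {p : unitInterval} (hπ : ∀ r : ℕ, 1 ≤ r → 0 < armProb p r)
    {s : ℝ} (hs : s < 1) : ¬ MassBoundAt p s := by
  rintro ⟨C, hC⟩
  refine not_forall_rpow_le (c := 1) (C := C) one_pos hs fun r hr => ?_
  have h := (succ_mul_armProb_le_mass p r).trans (hC r hr)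
  have h' : (r : ℝ) + 1 ≤ C * (r : ℝ) ^ s := le_of_mul_le_mul_right (by linarith) (hπ r hr)
  rw [Real.rpow_one]; linarith

/-! ### Positivity of the arm probabilities for `p > 0` (a straight open column), in particular at `p_c` -/

/-- The point `(k, 0, 0)` of the normal axis. [folklore] -/
def up (k : ℕ) : V3 := Pi.single 0 (k : ℤ)

/-- `up 0 = 0`. [folklore] -/
@[simp] theorem up_zero : up 0 = 0 := by simp [up]

/-- `up (k+1) = up k + e₀`. [folklore] -/
theorem up_succ (k : ℕ) : up (k + 1) = up k + Pi.single 0 1 := by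
  simp [up, ← Pi.single_add]

/-- The height of `up k` is `k`. [folklore] -/
theorem up_apply_zero (k : ℕ) : up k 0 = k := by simp [up]

/-- `up k ∈ ℍ`. [folklore] -/
theorem up_mem_Hs (k : ℕ) : up k ∈ Hs := by
  show (0 : ℤ) ≤ up k 0
  rw [up_apply_zero]; exact Int.natCast_nonneg k

/-- Consecutive points of the column are lattice neighbours. [folklore] -/
theorem adj_up_succ (k : ℕ) : (zdGraph 3).Adj (up k) (up (k + 1)) :=
  (zdGraph_adj_iff _ _).2 ⟨0, Or.inl (up_succ k)⟩

/-- The open column `{s(up k, up (k+1)) | k < r}`. [folklore] -/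
def column (r : ℕ) : Finset (Sym2 V3) := (Finset.range r).image fun k => s(up k, up (k + 1))

/-- The column consists of lattice edges. [folklore] -/
theorem column_subset_edgeSet (r : ℕ) : (↑(column r) : Set (Sym2 V3)) ⊆ (zdGraph 3).edgeSet := by
  intro e he
  rw [Finset.mem_coe, column, Finset.mem_image] at he
  obtain ⟨k, -, rfl⟩ := he
  exact (SimpleGraph.mem_edgeSet _).2 (adj_up_succ k)

/-- If the column is open, `up k` is reachable from `0` inside `ℍ` for `k ≤ r`. [folklore] -/
theorem reachable_up_of_column {ω : BondConfig V3} {r : ℕ} (hω : (↑(column r) : Set (Sym2 V3)) ⊆ ω)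
    {k : ℕ} (hk : k ≤ r) : (openGraph ω ⊓ withinGraph ⊤ Hs).Reachable 0 (up k) := by
  induction k with
  | zero => simp
  | succ k ih =>
    have hk' : k < r := Nat.lt_of_succ_le hk
    refine (ih hk'.le).trans (SimpleGraph.Adj.reachable ?_)
    have hne : up k ≠ up (k + 1) := (adj_up_succ k).ne
    have he : s(up k, up (k + 1)) ∈ ω := hω (by
      rw [Finset.mem_coe, column, Finset.mem_image]; exact ⟨k, Finset.mem_range.2 hk', rfl⟩)
    rw [SimpleGraph.inf_adj, openGraph_adj, withinGraph_adj, SimpleGraph.top_adj]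
    exact ⟨⟨he, hne⟩, hne, up_mem_Hs k, up_mem_Hs (k + 1)⟩

/-- An open column of height `r` realises `arm_ℍ(0,r)`. [folklore] -/
theorem setOf_column_subset_arm (r : ℕ) : {ω : BondConfig V3 | ↑(column r) ⊆ ω} ⊆ arm r := by
  intro ω hω
  rw [mem_arm_iff]
  refine ⟨up r, ?_, reachable_up_of_column hω le_rfl⟩
  simp [snorm, up]

/-- `π_p(r) ≥ p^{|column r|} > 0` for `p > 0`. [folklore] -/
theorem armProb_pos {p : unitInterval} (hp : 0 < (p : ℝ)) (r : ℕ) : 0 < armProb p r := by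
  have h := bondPercolation_real_setOf_subset (zdGraph 3) p (column r) (column_subset_edgeSet r)
  have hpos : 0 < (p : ℝ) ^ (column r).card := pow_pos hp _
  calc 0 < (Pp p).real {ω | ↑(column r) ⊆ ω} := by rw [Pp, h] at *; exact hpos
    _ ≤ armProb p r := measureReal_mono (setOf_column_subset_arm r)

/-- `p_c(ℤ³) > 0` (tree: `criticalProb_zd_pos`). [folklore] -/
theorem criticalProbI_pos : 0 < ((criticalProbI 3 : unitInterval) : ℝ) := by
  rw [coe_criticalProbI]; exact criticalProb_zd_pos 3 (by norm_num)

/-- `π_{p_c}(r) > 0` for every `r`. [folklore] -/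
theorem armProb_criticalProbI_pos (r : ℕ) : 0 < armProb (criticalProbI 3) r :=
  armProb_pos criticalProbI_pos r

/-- NATURAL STRENGTHENING REFUTED (exponent side): at `p_c(ℤ³)` the conditional mass exponent is
`≥ 1` — `MassBoundAt p_c s` is FALSE for every `s < 1`. (So the true `m` lies in `[1, 3]`; the crux
asserts `m ≤ 11/4`.) [folklore] -/
theorem not_massBoundAt_criticalProbI_of_lt_one {s : ℝ} (hs : s < 1) :
    ¬ MassBoundAt (criticalProbI 3) s :=
  not_massBoundAt_of_lt_one (fun r _ => armProb_criticalProbI_pos r) hs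


end Summit.CriticalPhenomena.PercolationContinuityZ3.Theorems.TallClusterMassBound.Negative
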